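import Mathlib.NumberTheory.LegendreSymbol.QuadraticChar.Basic
import Literature.NumberTheory.Automorphic.BCDTModularity
import Literature.NumberTheory.EllipticCurves.HeckeEisensteinWeightOneForm
import Mathlib.NumberTheory.NumberField.Basic
import Mathlib.RingTheory.DedekindDomain.AdicValuation
import HarnessLib

/-!
# Stub-ideation k = 1, GENERATION 14 (home family 1 = RECOGNISE & IMPORT) for `stub_liftThree`
# of crux `FreyModularity` (stmt-ABC-11340, route ABC/DefiniteXi, `Lines/Sketch.lean`, sha 21576c53)

Companion of `STUB-IDEAS-stub_liftThree-1.md` (gen 14).  Gen 13 (`STUB_IDEAS_stub_liftThree_1g13`)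
reduced `stub_liftThree` AND `stub_liftFive` to ONE socket
`DiamondCSS62 ℓ → IN1 ℓ → OrdOfMult ℓ → CrysOfGood ℓ → ModularityLifting_tate ℓ` and left three
unproved inputs: `DiamondCSS62` (the `R = T` output), `IN1` (any weight ⇒ weight 2 for `ρ̄`),
`CrysOfGood`.  This generation attacks **`IN1` at `ℓ = 3` in the branch the Frey pipeline actually
exercises** — the WEIGHT-ONE witness produced by `stub_modThree` (Langlands–Tunnell) — and finds
that the tree already holds every analytic ingredient of Wiles' `E_{1,χ}` trick
(Gelbart, CSS Ch. VI §1.4 Step 4; DDT Rem. 3.6):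

* `IN1 p ↔ IN1one p ∧ IN1high p` (`in1_iff`, PROVED): the weight-`1` slice and the weight-`≥ 2`
  slice of the tree's any-weight `ModPGaloisRep.IsModular`;
* the multiplier `E13 = 6 c₁⁻¹ G̃_{χ₃}(·,0) ∈ M₁(Γ₁(3))` built from the tree's Hecke weight-one
  Eisenstein series `heckeOneMF` (`HeckeEisensteinWeightOneForm`) and its normalisation
  (`HeckeEisensteinWeightOneUnit.inv_heckeOneConst_mul_heckeOneCoeff_zero`: constant term
  `-B_{1,χ̄}/2 = 1/6` for `χ = χ₃`; that module is not imported — its closure is unbuilt on the farm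
  today — the constant `c₁` is inlined), with nebentypus law PROVED here (`E13_slash_of_mem_gamma0`);
  helper TARGET `E13QExpansion` (`E13 = 1 + 6 Σ σ^{χ₃}(n) qⁿ ≡ 1 (mod 6)`);
* helper TARGET `WeightTwoNewformCongrThree N` = the tree's PROVED
  `exists_newform_congr_of_weight_one` (Deligne–Serre 6.8–6.11 + Atkin–Lehner–Li, multiplier `E_k`,
  output weight `k' ≥ 3`) re-run with the multiplier `E13` (output weight `2`, level `∣ 3N`,
  nebentypus `ε χ₃`, `ε_{g₀}(p) p ≡ ε(p)`);
* helper TARGET `AttachAlongCongruence` (Chebotarev + Brauer–Nesbitt glue, template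
  `thm67_weightOne_core` / `ResidualRepOfTraceCongruence`) giving `IN1one 3`.

Kernel status: NO `sorry`; helper STATEMENTS are `def … : Prop`, every `theorem` is proved.
-/

noncomputable section

open scoped MatrixGroups Matrix NumberField ModularForm Real UpperHalfPlane Topology Manifold
open Complex UpperHalfPlane ModularForm ModularFormClass
open NumberField IsDedekindDomain IsDedekindDomain.HeightOneSpectrum Filter
open Literature.NumberTheory Literature.NumberTheory.Automorphic Literature.NumberTheory.Automorphic.BCDT
open Literature.NumberTheory.GaloisRepresentations Literature.NumberTheory.GaloisRepresentations.ModPGaloisRep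
open Literature.NumberTheory.EllipticCurves Literature.NumberTheory.EllipticCurves.ModularForms
open Literature.NumberTheory.LFunctions
open CongruenceSubgroup

namespace Summit.ABC.ABC.Cruxes.FreyModularity.StubIdeas.LiftThree1g14

/-! ## §0 The socket's input adapter `IN1` (k1-liftFive-g6 / k1-g13, verbatim) -/

/-- **DDT Def. 3.12 — `ρ̄` modular of WEIGHT 2** (k1-g13, verbatim). [cite: DarmonDiamondTaylor1995, Def. 3.12] -/
def IsModularWeightTwo {k : Type} [Field k] [TopologicalSpace k] [DiscreteTopology k]
    (ρ : ModPGaloisRep ℚ k 2) : Prop :=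
  ∃ (N : ℕ) (_ : NeZero N) (f : CuspForm (Gamma1 N) 2) (K : Type) (_ : Field K)
    (_ : TopologicalSpace K) (_ : DiscreteTopology K) (j : k →+* K)
    (ι : coeffCharIntegers f →+* K),
    IsNewform1 f ∧
      IsGaloisRepOfNewform1Int f ι {q | q ∣ N * ringChar k}
        (FramedRep.baseChange j continuous_of_discreteTopology ρ)

/-- **IN1** (k1-g13, verbatim): absolutely irreducible `ρ̄`, modular of ANY weight ⇒ modular of
weight 2. [cite: AshStevens1986, Thm. 3.5] [cite: DeligneSerreASENS1974, 6.9–6.11] -/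
def IN1 (p : ℕ) [Fact p.Prime] : Prop :=
  ∀ ρ : ModPGaloisRep ℚ (ZMod p) 2, FramedRep.IsAbsolutelyIrreducible ρ → ρ.IsModular →
    IsModularWeightTwo ρ

/-! ## §1 Weight slices: `IN1 = IN1one ∧ IN1high` (PROVED) -/

/-- The weight-`w` slice of the tree's `ModPGaloisRep.IsModular`. [cite: BCDTJAMS2001, Introduction] -/
def IsModularOfWeight {k : Type} [Field k] [TopologicalSpace k] [DiscreteTopology k] (w : ℤ)
    (ρ : ModPGaloisRep ℚ k 2) : Prop :=
  ∃ (N : ℕ) (_ : NeZero N) (f : CuspForm (Gamma1 N) w) (K : Type) (_ : Field K)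
    (_ : TopologicalSpace K) (_ : DiscreteTopology K) (j : k →+* K)
    (ι : coeffCharIntegers f →+* K),
    IsNewform1 f ∧
      IsGaloisRepOfNewform1Int f ι {q | q ∣ N * ringChar k}
        (FramedRep.baseChange j continuous_of_discreteTopology ρ)

variable {k : Type} [Field k] [TopologicalSpace k] [DiscreteTopology k]

/-- `IsModular` is the union of its weight slices `w ≥ 1`. [folklore] -/
theorem isModular_iff_exists_weight (ρ : ModPGaloisRep ℚ k 2) :
    ρ.IsModular ↔ ∃ w : ℤ, 1 ≤ w ∧ IsModularOfWeight w ρ := by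
  constructor
  · rintro ⟨N, hN, w, f, K, hK, hT, hD, j, ι, hw, hf, hatt⟩
    exact ⟨w, hw, N, hN, f, K, hK, hT, hD, j, ι, hf, hatt⟩
  · rintro ⟨w, hw, N, hN, f, K, hK, hT, hD, j, ι, hf, hatt⟩
    exact ⟨N, hN, w, f, K, hK, hT, hD, j, ι, hw, hf, hatt⟩

/-- Weight-2 modular = the `w = 2` slice. [folklore] -/
theorem isModularWeightTwo_iff (ρ : ModPGaloisRep ℚ k 2) :
    IsModularWeightTwo ρ ↔ IsModularOfWeight 2 ρ := Iff.rfl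

/-- **IN1, weight-one slice** (the branch exercised by the Frey pipeline: the residual-modularity
witness of `stub_modThree` is the weight-one Langlands–Tunnell newform). [cite: Wiles1995, Ch. 5]
[cite: DarmonDiamondTaylor1995, Rem. 3.6] -/
def IN1one (p : ℕ) [Fact p.Prime] : Prop :=
  ∀ ρ : ModPGaloisRep ℚ (ZMod p) 2, FramedRep.IsAbsolutelyIrreducible ρ → IsModularOfWeight 1 ρ →
    IsModularWeightTwo ρ

/-- **IN1, weight `≥ 2` slice** (named-fact size: Ash–Stevens 1986 Thm. 3.5 for `p ≥ 5`; at `p = 3`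
the printed source must be checked — Ribet's 1994 report §2–3 / Edixhoven 1992 §3–4).
[cite: AshStevens1986, Thm. 3.5] -/
def IN1high (p : ℕ) [Fact p.Prime] : Prop :=
  ∀ ρ : ModPGaloisRep ℚ (ZMod p) 2, FramedRep.IsAbsolutelyIrreducible ρ → ∀ w : ℤ, 2 ≤ w →
    IsModularOfWeight w ρ → IsModularWeightTwo ρ

/-- **`IN1 p ↔ IN1one p ∧ IN1high p`** (PROVED). [folklore] -/
theorem in1_iff (p : ℕ) [Fact p.Prime] : IN1 p ↔ IN1one p ∧ IN1high p := by
  constructor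
  · intro h
    refine ⟨fun ρ hirr h1 ↦ h ρ hirr ?_, fun ρ hirr w hw hW ↦ h ρ hirr ?_⟩
    · exact (isModular_iff_exists_weight ρ).mpr ⟨1, le_rfl, h1⟩
    · exact (isModular_iff_exists_weight ρ).mpr ⟨w, by omega, hW⟩
  · rintro ⟨h1, h2⟩ ρ hirr hmod
    obtain ⟨w, hw, hW⟩ := (isModular_iff_exists_weight ρ).mp hmod
    rcases eq_or_lt_of_le hw with h | h
    · subst h
      exact h1 ρ hirr hW
    · exact h2 ρ hirr w (by omega) hW

/-- The weight-one slice and the high slice give `IN1` (the direction the socket consumes). [folklore] -/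
theorem in1_of_one_high (p : ℕ) [Fact p.Prime] (h1 : IN1one p) (h2 : IN1high p) : IN1 p :=
  (in1_iff p).mpr ⟨h1, h2⟩

/-! ## §2 The multiplier `E_{1,χ₃} = 1 + 6 Σ σ^{χ₃}(n) qⁿ ∈ M₁(Γ₁(3))` from the tree -/

/-- The odd quadratic character modulo `3` (Legendre symbol `(·/3)`), with values in `ℂ`. [folklore] -/
def chi3 : DirichletCharacter ℂ 3 := (quadraticChar (ZMod 3)).ringHomComp (Int.castRingHom ℂ)

/-- `χ₃` is quadratic. [folklore] -/
theorem chi3_isQuadratic : chi3.IsQuadratic := (quadraticChar_isQuadratic (ZMod 3)).comp _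

/-- `χ₃⁻¹ = χ₃`. [folklore] -/
theorem chi3_inv : chi3⁻¹ = chi3 := chi3_isQuadratic.inv

/-- `χ₃(-1) = -1`: `χ₃` is odd. [folklore] -/
theorem chi3_odd : chi3.Odd := by
  have h3 : ringChar (ZMod 3) ≠ 2 := by rw [ZMod.ringChar_zmod_n]; decide
  have h : quadraticChar (ZMod 3) (-1) = -1 := by
    rw [quadraticChar_neg_one h3, ZMod.card]
    exact ZMod.χ₄_nat_three_mod_four (by norm_num)
  show chi3 (-1) = -1
  simp [chi3, MulChar.ringHomComp_apply, h]

/-- `χ₃ ≠ 1`. [folklore] -/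
theorem chi3_ne_one : chi3 ≠ 1 := by
  intro h
  have hodd := chi3_odd
  rw [DirichletCharacter.Odd, h, MulChar.one_apply isUnit_one.neg] at hodd
  norm_num at hodd

/-- `χ₃` is primitive (conductor `3`). [folklore] -/
theorem chi3_isPrimitive : chi3.IsPrimitive := by
  have hdvd : chi3.conductor ∣ 3 := DirichletCharacter.conductor_dvd_level chi3
  rcases (Nat.dvd_prime Nat.prime_three).mp hdvd with h1 | h3
  · exact absurd ((DirichletCharacter.eq_one_iff_conductor_eq_one (χ := chi3)).mpr h1) chi3_ne_one
  · exact h3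

/-- **The multiplier** `E13 = 6 c₁⁻¹ · G̃_{χ₃}(·,0)`, `c₁ = -4πiτ(χ₃)/3` (= `heckeOneConst χ₃` of
`HeckeEisensteinWeightOneUnit`, inlined here because that module's import closure is unbuilt on the
farm today): the tree's Hecke weight-one Eisenstein series for `χ₃`, normalised to constant term
`6 · (-B_{1,χ₃}/2) = 1` (`inv_heckeOneConst_mul_heckeOneCoeff_zero`, `B_{1,χ₃} = -1/3`); classically
`E_{1,χ} = 1 + 6 Σ_{n ≥ 1} (Σ_{d ∣ n} χ(d)) qⁿ` = the theta series of the hexagonal lattice.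
[cite: Miyake2006, Thm. 7.2.13] [cite: Wiles1995, Ch. 5] -/
def E13 : ModularForm (Gamma1 3) 1 :=
  ((6 : ℂ) * (-(4 * π * Complex.I * gaussSum chi3 (ZMod.stdAddChar (N := 3)) / 3))⁻¹) •
    heckeOneMF chi3 chi3_isPrimitive chi3_odd

/-- **Nebentypus law of the multiplier** (PROVED): `E13 ∣₁ γ = χ₃(d_γ) E13` for `γ ∈ Γ₀(3)`
(`heckeOneMF_slash_of_mem_gamma0` gives `χ₃⁻¹ = χ₃`). [cite: Miyake2006, Thm. 7.2.13] -/
theorem E13_slash_of_mem_gamma0 {γ : SL(2, ℤ)} (hγ : γ ∈ Gamma0 3) :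
    (⇑E13 : ℍ → ℂ) ∣[(1 : ℤ)] γ = chi3 ((γ 1 1 : ℤ) : ZMod 3) • (⇑E13 : ℍ → ℂ) := by
  have h := heckeOneMF_slash_of_mem_gamma0 chi3 chi3_isPrimitive chi3_odd hγ
  rw [chi3_inv] at h
  have hcoe : (⇑E13 : ℍ → ℂ) =
      ((6 : ℂ) * (-(4 * π * Complex.I * gaussSum chi3 (ZMod.stdAddChar (N := 3)) / 3))⁻¹) •
        (⇑(heckeOneMF chi3 chi3_isPrimitive chi3_odd) : ℍ → ℂ) := rfl
  rw [hcoe, ModularForm.SL_smul_slash, h, smul_smul, smul_smul, mul_comm]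

/-- **H1 (helper target, size S): the `q`-expansion of the multiplier**,
`E13 = 1 + 6 Σ_{n ≥ 1} σ^{χ₃}(n) qⁿ` — so its coefficients are integers, the constant term is `1`
and all others are divisible by `6`: `E13 ≡ 1 (mod 6)`.  From `qExpansion_coeff_heckeOneMF`,
`heckeOneCoeff_of_ne_zero`, `inv_heckeOneConst_mul_heckeOneCoeff_zero` and the one-line evaluation
`generalizedBernoulli 1 χ₃ = -1/3`. [cite: Miyake2006, Thm. 7.2.13] [cite: Wiles1995, Ch. 5 (p. 544)] -/
def E13QExpansion : Prop :=
  ∀ n : ℕ, (qExpansion 1 ⇑E13).coeff n =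
    if n = 0 then (1 : ℂ) else 6 * ∑ d ∈ n.divisors, chi3 (d : ZMod 3)

/-- **The character congruence that replaces Fermat's `p^{k'-1} ≡ 1`** in Deligne–Serre 6.9 for the
multiplier `E13` (PROVED): `χ₃(p) · p ≡ 1 (mod 3)` for `3 ∤ p`, i.e. `x · (x/3) = 1` in `𝔽₃` for
`x ≠ 0` (`χ₃ = ω = ω⁻¹` modulo `3`), so the Hecke polynomial `X² - a_p X + ε(p)χ₃(p) p` of the
weight-2 product reduces to `X² - a_p X + ε(p)` of the weight-1 form. [folklore] -/
theorem cast_quadraticChar_mul_self (x : ZMod 3) (hx : x ≠ 0) :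
    ((quadraticChar (ZMod 3) x : ℤ) : ZMod 3) * x = 1 := by
  revert x
  decide

/-! ## §3 Deligne–Serre 6.8–6.11 with the multiplier `E13`: a congruent newform of WEIGHT 2 -/

/-- **H3 (helper target, size M — a re-run of the tree's PROVED
`NewformGaloisRepModLOfNewform.exists_newform_congr_of_weight_one` /
`DeligneSerre1974.exists_eigenform_congr_of_weight_one` with `E_k` replaced by `E13`)**: for a
weight-one newform `f ∈ S₁(Γ₁(N))` and `ι : 𝓞_f → 𝔽₃` there are a number field `K ⊆ ℂ`, an
embedding `i : K_f → K`, a finite place `v ∣ ker ι` of `K` and a NEWFORM `g₀` of WEIGHT 2 and level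
`M₀ ∣ 3N` with `v`-integral eigenvalues `a_p(g₀) ≡ a_p(f)` and `ε_{g₀}(p) p ≡ ε_f(p)` (mod `v`) for
`p ∤ 3N`.  Proof plan: `x = [f]₍₃N₎ · [E13]₍₃N₎ ∈ S₂(Γ₁(3N))` (degeneracy maps `degeneracyMap1 N (N*3) 1`,
`mulModularForm`, `qExpansion_mulModularForm_gamma1`) has `v`-integral `q`-expansion `≡ f`
(`E13QExpansion`), lies in the nebentypus subspace of `ε χ₃` (`E13_slash_of_mem_gamma0`, pattern
`diamondOp_mulModularForm_of_slash_chi4`), and is a mod-`v` eigenvector of `T_p`, `p ∤ 3N`, with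
eigenvalues `a_p(f)` (`cast_quadraticChar_mul_self` in place of Fermat); then Deligne–Serre 6.11
(`DeligneSerre1974.exists_eigenvector_lift`) and Atkin–Lehner–Li (`exists_isNewform1_of_eigenpacket`)
exactly as in the tree — WITHOUT the final level-raising step (the level is already `3N`).
[cite: DeligneSerreASENS1974, 6.9–6.11] [cite: DarmonDiamondTaylor1995, Rem. 3.6]
[cite: DiamondShurman2005, Thm. 5.8.2] -/
def WeightTwoNewformCongrThree (N : ℕ) [NeZero N] : Prop :=
  ∀ (f : CuspForm (Gamma1 N) 1), IsNewform1 f → ∀ ι : coeffCharIntegers f →+* ZMod 3,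
    ∃ (K : IntermediateField ℚ ℂ) (_ : NumberField K) (i : coeffCharField f →+* K)
      (v : HeightOneSpectrum (𝓞 K)) (M₀ : ℕ) (_ : NeZero M₀) (_ : M₀ ∣ N * 3)
      (g₀ : CuspForm (Gamma1 M₀) 2) (a : ℕ → K) (c : ZMod M₀ → K),
      coeffCharField g₀ ≤ K ∧ (∀ y, ((i y : K) : ℂ) = y) ∧
      IsNewform1 g₀ ∧ (∀ n, ((a n : K) : ℂ) = cuspCoeff g₀ n) ∧
      (∀ d, ((c d : K) : ℂ) = nebentypus g₀ d) ∧
      (∀ y : coeffCharIntegers f, ι y = 0 → v.valuation K (i y) < 1) ∧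
      (∀ n : ℕ, v.valuation K (a n) ≤ 1) ∧
      (∀ p : ℕ, p.Prime → ¬ p ∣ N * 3 →
        v.valuation K (a p - i ⟨cuspCoeff f p, cuspCoeff_mem_coeffCharField f p⟩) < 1) ∧
      (∀ p : ℕ, p.Prime → ¬ p ∣ N * 3 →
        v.valuation K (c p * p -
          i ⟨(nebentypus f (p : ZMod N) : ℂ), nebentypus_mem_coeffCharField f p⟩) < 1)

/-! ## §4 Glue and assembly -/

/-- **H4 (helper target, size M): attachment along the congruence** — from the congruent weight-2
newform `g₀` of H3 (eigenvalue packet `≡` that of the weight-one witness at all `p ∤ 3N`) to the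
weight-2 attachment `IsGaloisRepOfNewform1Int g₀ …` of `ρ̄ ⊗ K'`, for absolutely irreducible `ρ̄`:
Chebotarev + Brauer–Nesbitt (tree: `ChebotarevDensityProofs`, `ResidualRepOfTraceCongruence`,
template `thm67_weightOne_core`), using the weight-2 Galois representations of `g₀`
(`eichlerShimuraConstruction`, already a hypothesis of `FreyModularity_of` via `stub_threeImpTwo`).
[cite: DeligneSerreASENS1974, 6.12–6.13] [cite: DarmonDiamondTaylor1995, Thm. 3.1] -/
def AttachAlongCongruence : Prop :=
  (∀ (N : ℕ) [NeZero N], WeightTwoNewformCongrThree N) → IN1one 3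

/-- **Assembly of the exercised branch** (PROVED, trivial logic): H3 at every level + H4 ⇒ `IN1one 3`;
with the named fact `IN1high 3` this is `IN1 3`, the socket input of gen 13
(`modularityLifting_tate_of_socket 3`). [folklore] -/
theorem in1_three_of_helpers (h3 : ∀ (N : ℕ) [NeZero N], WeightTwoNewformCongrThree N)
    (h4 : AttachAlongCongruence) (hhigh : IN1high 3) : IN1 3 :=
  in1_of_one_high 3 (h4 h3) hhigh

end Summit.ABC.ABC.Cruxes.FreyModularity.StubIdeas.LiftThree1g14
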